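import Literature.MathematicalPhysics.QuantumFieldTheory.Balaban1983to89.Node00.StepWeightsOfRecord

/-!
# YM-DAG node N21 (= NE7c) — (POS) IS ALREADY IN THE TREE FOR THE STEP WEIGHTS OF RECORD: the two DISPLAYED laws of def-T's residual fluctuation factor,
# `Node00.IsZetaUnity` (`Σ_{(R,S)} ζ = 1`) and `Node00.IsZetaAbsLeOne` (`Σ_{(R,S)} |ζ| ≤ 1`), FORCE `ζ ≥ 0` termwise, hence the label weights `Node00.ωOfRecord`
# of the T-step of record are NONNEGATIVE — the (POS) clause of lens (t-n″) for the selection road's lineage structure, at NODE 00's own typed object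

Track A of `YM-PLAN.md` (cell `pub-ymgap`, HUMAN RULING D-0062), node **N21**; R134 fan-out seat `pub-ymgap-dag-n21-d` (s2), generation 5, module 22.  THEOREMS ONLY:
0 `def`, 0 `sorry`, standard axioms; COUNT-NEUTRAL; `--supports` the K3‴ item `SpineGivenEndpointR13` (stmt-QuantumFields-19912) as a helper.  NO Theses import, NO
`Node00.Record13` import.  Imports def-T's `Node00.StepWeightsOfRecord` only (the step weights of record: labels `(P,Q,R,S)_{k+1}`, weights
`ωOfRecord A₁ ζ s t (U,V') = a(P)·b(P,Q)·ζ(R,S)`, `aWeight_nonneg`, `bWeight_nonneg`, the ζ-laws `IsZetaUnity` ∕ `IsZetaAbsLeOne`, and the pointwise label unity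
`labelUnity_ωOfRecord`), whose header says «no positivity of ζ assumed».

THE POINT.  Lens `LENS-nearmiss.md` v5.0 (t-n″) asks NODE O's threshold-parametric term object to come LINEAGE-STRUCTURED with (POS) and (NO-DROP) manifest; modules
20b∕20c (ROW A‴) and 20 turn that structure into N21's `LevelLedger`s ∕ `ShellWeightBound` at selected thresholds.  The ONE typed piece of that object existing today is
def-T's T-step of record with its label weights `ωOfRecord` ([III] (3.2)·(3.3) pinned, (3.16)·(3.20)·(3.21) as the residual `ζ`).  This file records that (POS) for it is
NOT an extra input: a finite real family summing to `1` whose absolute values sum to at most `1` is termwise nonnegative (§1, [folklore]), so `IsZetaUnity ∧ IsZetaAbsLeOne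
⇒ ζ ≥ 0` (§2 `zetaOfRecord_nonneg`) and `ωOfRecord ≥ 0` (§2 `ωOfRecord_nonneg`, with `aWeight_nonneg`, `bWeight_nonneg`); with `labelUnity_ωOfRecord` the labels of one
T-step are a genuine (χ-weighted) PARTITION OF UNITY BY NONNEGATIVE WEIGHTS — the (D)+(POS) clauses of the lineage structure for this step, `Σ|ω| = Σω`
(§2 `sum_abs_ωOfRecord_eq_sum`).

HONEST FRAMING (binding).  Kernel bookkeeping on def-T's displayed laws; nothing of Bałaban's asserted (the ζ-laws stay DISPLAYED hypotheses of NODE 00 — dischargeable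
when the minimiser of (3.10) gets a body, def-T's words); this is ONE clause ((POS) for ONE step's labels) of (t-n″), not the lineage structure (kernels for the younger
steps, the start-of-step state laws, (NO-DROP) along the tower are NOT typed here); NE7c NOT PRINTED and NOT PROVED; **N21 is NOT discharged**; typed 28∕28, discharged
count untouched; one finite four-torus programme at fixed `ε` — NOT ℝ⁴, NOT infinite volume, NOT OS, NOT a mass gap, NOT Clay.  No decl below carries a cite tag.
-/

set_option autoImplicit false

open scoped BigOperators

namespace Summit.QuantumFields.YangMills.Theorems.N21StepWeightsPositivity

open Literature.MathematicalPhysics.QuantumFieldTheory.Balaban1983to89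
open Literature.MathematicalPhysics.QuantumFieldTheory.Balaban1983to89.T4Continuum (T4Family)
open Node00

/-! ## §1 A finite family summing to `1` with absolute sum `≤ 1` is nonnegative -/

/-- **UNITY + ABSOLUTE SUB-UNITY ⇒ POSITIVITY**: if `Σ_i f i = 1` and `Σ_i |f i| ≤ 1` over a finite type, then every `f i ≥ 0` (otherwise `Σ f < Σ |f| ≤ 1 = Σ f`).
[folklore] -/
theorem nonneg_of_sum_eq_one_of_sum_abs_le_one {ι : Type*} [Fintype ι] (f : ι → ℝ) (h1 : ∑ i, f i = 1) (h2 : ∑ i, |f i| ≤ 1)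
    (i : ι) : 0 ≤ f i := by
  by_contra hneg
  push Not at hneg
  have hlt : f i < |f i| := by rw [abs_of_neg hneg]; linarith
  have : ∑ j, f j < ∑ j, |f j| := Finset.sum_lt_sum (fun j _ => le_abs_self (f j)) ⟨i, Finset.mem_univ i, hlt⟩
  linarith

/-- … and then the absolute values ARE the values: `Σ_i |f i| = Σ_i f i (= 1)`. [folklore] -/
theorem sum_abs_eq_sum_of_sum_eq_one_of_sum_abs_le_one {ι : Type*} [Fintype ι] (f : ι → ℝ) (h1 : ∑ i, f i = 1) (h2 : ∑ i, |f i| ≤ 1) :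
    ∑ i, |f i| = ∑ i, f i :=
  Finset.sum_congr rfl fun i _ => abs_of_nonneg (nonneg_of_sum_eq_one_of_sum_abs_le_one f h1 h2 i)

/-! ## §2 The step weights of record are nonnegative -/

section StepWeights

variable (F : T4Family) (N : ℕ) [NeZero N] (ν : Stage7Numerics) (M : ℕ)

omit [NeZero N] in
/-- **THE RESIDUAL FLUCTUATION FACTOR OF RECORD IS NONNEGATIVE** under its two displayed laws: `IsZetaUnity` (`Σ_{(R,S)} ζ = 1`) and `IsZetaAbsLeOne`
(`Σ_{(R,S)} |ζ| ≤ 1`) give `0 ≤ ζ p g k s P Q (R,S) U V'` for every label — (POS) for the (3.16)·(3.20)·(3.21) factor is a CONSEQUENCE, not an extra law. [folklore] -/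
theorem zetaOfRecord_nonneg {ζ : ZetaOfRecord F N ν M} (hu : IsZetaUnity F N ν M ζ) (ha : IsZetaAbsLeOne F N ν M ζ)
    (p : B12.RunParams) (g : ℕ → ℝ) (k : ℕ) (s : SeqOfRecord F ν M g p.K k) (Pl Ql : Finset (Iχ F ν p g k))
    (RS : Finset (Iχ F ν p g k) × Finset (Iχ F ν p g k)) (U : GaugeField (F.P p.K) k (SU N)) (V' : GaugeField (F.P p.K) (k + 1) (SU N)) :
    0 ≤ ζ p g k s Pl Ql RS U V' :=
  nonneg_of_sum_eq_one_of_sum_abs_le_one (fun RS => ζ p g k s Pl Ql RS U V') (hu p g k s Pl Ql U V') (ha p g k s Pl Ql U V') RS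

/-- **THE LABEL WEIGHTS OF RECORD ARE NONNEGATIVE**: `0 ≤ ωOfRecord A₁ ζ s t (U, V') = a(P)·b(P,Q)·ζ(R,S)` — def-T's `aWeight_nonneg`, `bWeight_nonneg` (products of
`{0,1}`-valued (3.2)∕(3.3) factors) and `zetaOfRecord_nonneg`.  With def-T's `labelUnity_ωOfRecord` the labels of the T-step of record are a χ-weighted PARTITION OF UNITY BY
NONNEGATIVE WEIGHTS — the (D)+(POS) clauses of lens (t-n″) for this step. [folklore] -/
theorem ωOfRecord_nonneg {ζ : ZetaOfRecord F N ν M} (hu : IsZetaUnity F N ν M ζ) (ha : IsZetaAbsLeOne F N ν M ζ)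
    (p : B12.RunParams) (g : ℕ → ℝ) (k : ℕ) (A₁ : ℝ) (s : SeqOfRecord F ν M g p.K k) (t : LbOfRecord F ν p g k)
    (U : GaugeField (F.P p.K) k (SU N)) (V' : GaugeField (F.P p.K) (k + 1) (SU N)) :
    0 ≤ ωOfRecord F N ν M p g k A₁ ζ s t U V' := by
  unfold ωOfRecord
  exact mul_nonneg (mul_nonneg (aWeight_nonneg F N ν M p g k s t.1 V') (bWeight_nonneg F N ν M p g k A₁ s t.1 t.2.1 U V'))
    (zetaOfRecord_nonneg F N ν M hu ha p g k s t.1 t.2.1 t.2.2 U V')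

/-- **HENCE `Σ_t |ω| = Σ_t ω`**: the absolute label mass of def-T's `sum_abs_ωOfRecord_le_one` IS the label mass — no cancellation between labels. [folklore] -/
theorem sum_abs_ωOfRecord_eq_sum {ζ : ZetaOfRecord F N ν M} (hu : IsZetaUnity F N ν M ζ) (ha : IsZetaAbsLeOne F N ν M ζ)
    (p : B12.RunParams) (g : ℕ → ℝ) (k : ℕ) (A₁ : ℝ) (s : SeqOfRecord F ν M g p.K k)
    (U : GaugeField (F.P p.K) k (SU N)) (V' : GaugeField (F.P p.K) (k + 1) (SU N)) :
    ∑ t : LbOfRecord F ν p g k, |ωOfRecord F N ν M p g k A₁ ζ s t U V'| = ∑ t : LbOfRecord F ν p g k, ωOfRecord F N ν M p g k A₁ ζ s t U V' :=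
  Finset.sum_congr rfl fun t _ => abs_of_nonneg (ωOfRecord_nonneg F N ν M hu ha p g k A₁ s t U V')

end StepWeights

end Summit.QuantumFields.YangMills.Theorems.N21StepWeightsPositivity
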